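/-
Copyright (c) 2026 the pub-hodgecm-mathlib formalisation cell (harness21).  Prover seat hodgecm-mathlib-K2Liu-p01 (g0): Track B «K2-LIT», #184♮ = hLiu418,
helper H5 for socket #13 `sig_K2LiuDoublingUnfold` (U5 «DOUBLING ZETA», LEAD F0P6-plan (g10) DEAL BY NAME K2/STATUS 2026-09-03T21:14:18Z, RULING 21:19:59Z).
-/
import Literature.NumberTheory.Automorphic.AdelicSimilitudeCongr
import HarnessLib

/-!
# Crux `HLiu418`, Track B road `K2_Liu`, unit U5, helper H5 for socket #13 `sig_K2LiuDoublingUnfold`: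
# the bridge `ιA : U(H)(𝔸) →* U(diag dV)(𝔸)` of #184♮ IS the similitude isomorphism `x ↦ g⁻¹ x g` — continuity, bijectivity, rational ↔ rational

Cell `hodgecm-mathlib`, crux item hLiu418 = `stmt-HodgeConjecture-24832`, route of record `HCCMUnconditional`; squad K2 ∕ K2Liu, LEAD F0P6-plan
(g10), prover K2Liu-p01 (g0) (REPORT-FIRST plan for #13, K2/STATUS 21:19:45Z, item H5).  THEOREMS ONLY (no `def`, no instance, no notation, no
named-fact hypothesis, no `sorry`, default heartbeats); imports ★ `AdelicSimilitudeCongr` (LH5-p04: (K0) `exists_adelicSimilCongr`, (K3)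
`similCongr_mem_quotientSubgroup_iff`) + HarnessLib; lane `--supports stmt-HodgeConjecture-24832 --as helper` (count-neutral).

THE BINDERS OF #184♮ ∕ #13.  `hg : formCongr c g (t • H) = diag dV` (`ᵗ(c g)·(tH)·g = diag dV`, `t ≠ 0`, `g ∈ GL_N(L)`) and a homomorphism
`ιA : (adelicGroupData L⁺ L c N H).Adelic →* U(diag dV)(𝔸)` pinned by its VALUES `hιA : (ιA k) = ĝ⁻¹ · k · ĝ` in `GL_N(𝔸_L)` (`ĝ = toAdeleGL L g`).
WHAT IS PROVED.  `simil_inv_of_formCongr` — `ᵗ(c g⁻¹)·(diag dV)·g⁻¹ = t • H` (★ `formCongr_inv_formCongr`), the similitude hypothesis of the ★ (K0)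
kit at `Q := g⁻¹`, `c := t`; `exists_continuousMulEquiv_coe_eq_iotaA` — there is `Φ : U(H)(𝔸) ≃ₜ* U(diag dV)(𝔸)` (★ (K0)) with the SAME values as
`ιA` (`exists_continuousMulEquiv_eq_iotaA`: `ιA = Φ` pointwise), hence **`iotaA_bijective`** and **`iotaA_mem_quotientSubgroup_iff`**
(continuity of `ιA` is already ★ `F0LD2FrameTransportPin.continuous_of_pin`, same binders — not restated):
`ιA x ∈ U(diag dV)(L⁺) ⟺ x ∈ U(H)(L⁺)` (★ (K3); `A_G = 1` on both sides) — the rationality ∕ surjectivity-onto-rational-points input of the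
single-orbit step of Liu 2021 Lem. B.11 (`γ ↦ P_Δ(L⁺) ι(ιA γ, 1)` exhausts `P_Δ(L⁺)\H(L⁺)` only because `ιA(Γ) = U(diag dV)(L⁺)`), and the
continuity input for the twist `φ₂^χ` of #13.

HONEST LABEL.  Count-neutral helper; `HC_CM` is proved only modulo the 7 printed citations (hLiu418 = 24832, h413 = 24833) until rung 0 closes.

## References
* [Liu2021] Y. Liu, *Fourier–Jacobi cycles and arithmetic relative trace formula*, Camb. J. Math. 9 (2021): App. B §B.3, Lem. B.11 p. 102.
* [PlatonovRapinchuk1994] V. Platonov, A. Rapinchuk, *Algebraic Groups and Number Theory* (1994): §2.3 (equivalent forms, conjugate unitary groups), §5.1.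
-/

noncomputable section

open scoped Matrix MatrixGroups
open NumberField IsDedekindDomain

namespace Summit.HodgeConjecture.HodgeConjecture.Cruxes.HLiu418.K2LiuDoublingUnfoldBridge

open Literature.NumberTheory.Automorphic Literature.NumberTheory.Automorphic.UnitaryGroup

variable (L : Type) [Field L] [NumberField L] [IsCMField L] {N : ℕ} (H : Matrix (Fin N) (Fin N) L) (dV : Fin N → L)
  (t : L) (ht : t ≠ 0) (g : GL (Fin N) L)
  (hg : formCongr ((IsCMField.complexConj L : L ≃ₐ[↥(maximalRealSubfield L)] L) : L →+* L) g (t • H) = Matrix.diagonal dV)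
  (ιA : (adelicGroupData (↥(maximalRealSubfield L)) L (IsCMField.complexConj L) N H).Adelic →*
    ↥(UnitaryGroup.adelic (↥(maximalRealSubfield L)) L (IsCMField.complexConj L) N (Matrix.diagonal dV)))
  (hιA : ∀ k, ((ιA k : ↥(UnitaryGroup.adelic (↥(maximalRealSubfield L)) L (IsCMField.complexConj L) N (Matrix.diagonal dV))) :
        GL (Fin N) (AdeleRing (𝓞 L) L)) =
      (toAdeleGL L g)⁻¹ * adelicVal (↥(maximalRealSubfield L)) L (IsCMField.complexConj L) N H k * toAdeleGL L g)

include hg in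
/-- **The similitude behind `hg`, read at `Q := g⁻¹`**: `ᵗ(c g⁻¹)·(diag dV)·g⁻¹ = t • H` (change the basis back, ★ `formCongr_inv_formCongr`) — the
hypothesis of the ★ (K0)∕(K3) kit `exists_adelicSimilCongr` ∕ `similCongr_mem_quotientSubgroup_iff` with `Ha := diag dV`, `Ha' := H`, `c := t`.
[cite: PlatonovRapinchuk1994, §2.3] -/
theorem simil_inv_of_formCongr :
    (((g⁻¹ : GL (Fin N) L) : Matrix (Fin N) (Fin N) L).map (cmConjRingHom L))ᵀ * Matrix.diagonal dV * ((g⁻¹ : GL (Fin N) L) : Matrix (Fin N) (Fin N) L) =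
      t • H := by
  have h := formCongr_inv_formCongr ((IsCMField.complexConj L : L ≃ₐ[↥(maximalRealSubfield L)] L) : L →+* L) g (t • H)
  rw [hg] at h
  exact h

include ht hg hιA in
/-- **`ιA` has the values of the ★ similitude isomorphism**: there is `Φ : U(H)(𝔸) ≃ₜ* U(diag dV)(𝔸)` (★ (K0) `exists_adelicSimilCongr` at `Q := g⁻¹`)
with `(Φ x) = (ιA x)` in `GL_N(𝔸_L)` for every `x` (`(toAdeleGL g⁻¹) x (toAdeleGL g⁻¹)⁻¹ = ĝ⁻¹ x ĝ`). [cite: PlatonovRapinchuk1994, §2.3, §5.1] -/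
theorem exists_continuousMulEquiv_coe_eq_iotaA :
    ∃ Φ : (cmDatum L N H).Adelic ≃ₜ* (cmDatum L N (Matrix.diagonal dV)).Adelic,
      ∀ x : (adelicGroupData (↥(maximalRealSubfield L)) L (IsCMField.complexConj L) N H).Adelic,
        (Subtype.val (Φ x) : GL (Fin N) (AdeleRing (𝓞 L) L)) =
          ((ιA x : ↥(UnitaryGroup.adelic (↥(maximalRealSubfield L)) L (IsCMField.complexConj L) N (Matrix.diagonal dV))) :
            GL (Fin N) (AdeleRing (𝓞 L) L)) := by
  obtain ⟨Φ, hΦ⟩ := exists_adelicSimilCongr L N (Matrix.diagonal dV) H t ht g⁻¹ (simil_inv_of_formCongr L H dV t g hg)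
  refine ⟨Φ, fun x => ?_⟩
  rw [hΦ x, hιA x, map_inv, inv_inv, adelicVal_apply]

include ht hg hιA in
/-- **`ιA` IS the similitude isomorphism** (pointwise): `ιA x = Φ x` for the `Φ` of `exists_continuousMulEquiv_coe_eq_iotaA`.
[cite: PlatonovRapinchuk1994, §2.3] -/
theorem exists_continuousMulEquiv_eq_iotaA :
    ∃ Φ : (cmDatum L N H).Adelic ≃ₜ* (cmDatum L N (Matrix.diagonal dV)).Adelic,
      (∀ x : (cmDatum L N H).Adelic, (Subtype.val (Φ x) : GL (Fin N) (AdeleRing (𝓞 L) L)) =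
          toAdeleGL L g⁻¹ * (Subtype.val x : GL (Fin N) (AdeleRing (𝓞 L) L)) * (toAdeleGL L g⁻¹)⁻¹) ∧
      ∀ x : (adelicGroupData (↥(maximalRealSubfield L)) L (IsCMField.complexConj L) N H).Adelic, Φ x = ιA x := by
  obtain ⟨Φ, hΦ⟩ := exists_adelicSimilCongr L N (Matrix.diagonal dV) H t ht g⁻¹ (simil_inv_of_formCongr L H dV t g hg)
  refine ⟨Φ, hΦ, fun x => Subtype.ext ?_⟩
  rw [hΦ x, hιA x, map_inv, inv_inv, adelicVal_apply]

include ht hg hιA in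
/-- **`ιA` is bijective** (it is a `≃ₜ*`). [cite: PlatonovRapinchuk1994, §2.3] -/
theorem iotaA_bijective : Function.Bijective ιA := by
  obtain ⟨Φ, -, hΦ⟩ := exists_continuousMulEquiv_eq_iotaA L H dV t ht g hg ιA hιA
  have h : (ιA : _ → _) = Φ := funext fun x => (hΦ x).symm
  rw [h]
  exact Φ.bijective

include ht hg hιA in
/-- **`ιA` carries rational points onto rational points**: `ιA x ∈ U(diag dV)(L⁺) ⟺ x ∈ U(H)(L⁺)` (the quotient subgroups of the two data — `A_G = 1` for
unitary groups, so these ARE the rational points; ★ (K3) `similCongr_mem_quotientSubgroup_iff`: `g` is rational).  With `iotaA_bijective` this says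
`ιA(U(H)(L⁺)) = U(diag dV)(L⁺)` — the input «every class of `P_Δ(L⁺)\H(L⁺)` is `P_Δ(L⁺) ι(ιA γ, 1)` for some `γ ∈ U(H)(L⁺)`» of the single-orbit step of
Liu 2021 Lem. B.11 at `a = 0`. [cite: Liu2021, Lem. B.11 p. 102] [cite: PlatonovRapinchuk1994, §2.3, §5.1] -/
theorem iotaA_mem_quotientSubgroup_iff (x : (adelicGroupData (↥(maximalRealSubfield L)) L (IsCMField.complexConj L) N H).Adelic) :
    (ιA x : (adelicGroupData (↥(maximalRealSubfield L)) L (IsCMField.complexConj L) N (Matrix.diagonal dV)).Adelic) ∈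
        (adelicGroupData (↥(maximalRealSubfield L)) L (IsCMField.complexConj L) N (Matrix.diagonal dV)).quotientSubgroup ↔
      x ∈ (adelicGroupData (↥(maximalRealSubfield L)) L (IsCMField.complexConj L) N H).quotientSubgroup := by
  obtain ⟨Φ, hΦv, hΦ⟩ := exists_continuousMulEquiv_eq_iotaA L H dV t ht g hg ιA hιA
  have key := similCongr_mem_quotientSubgroup_iff L N (Matrix.diagonal dV) H t ht g⁻¹ (simil_inv_of_formCongr L H dV t g hg) Φ hΦv x
  rw [hΦ x] at key
  exact key

end Summit.HodgeConjecture.HodgeConjecture.Cruxes.HLiu418.K2LiuDoublingUnfoldBridge
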